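import Literature.MathematicalPhysics.QuantumLattice.HubbardAtomicLimit
import Literature.MathematicalPhysics.QuantumLattice.DWaveSourceProofs

/-!
# Crux `TwSeededEnsembleEquivalence` (stmt-HubbardSuperconductivity-1698), line `exposed-density-duality` —
# structural barrier, stub B1b `stub_atomicHubbard_eq_diagonal`

In the atomic limit (hopping `t = 0`) the Hubbard Hamiltonian on the discrete torus `(ℤ/Lℤ)²` is
diagonal in the occupation-number basis, with eigenvalue `U · D(s)` on the configuration `s`, where
`D(s)` is the number of doubly occupied sites of `s` (written as the literal nested-filter count used
throughout the structural-barrier section of the skeleton).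

Proof: `hubbardTorus 2 L 0 U = hubbardTorusWith 2 L 0 U 0 = hamiltonianWith (fermionTorusGraph 2 L) 0 U 0`
(`hubbardTorusWith_zero`, definitional unfolding), and the tree's atomic-limit lemma
`hamiltonianWith_zero_hopping : hamiltonianWith G 0 U μ = diagonal (onSiteEnergy U μ)`
(`HubbardAtomicLimit.lean`, from `numberAt_eq_diagonal`) with
`onSiteEnergy U 0 s = U · #(doublyOccupied s)`; finally `doublyOccupied s = upPart s ∩ downPart s` is the
nested filter `{x | x↑ ∈ s}.filter (x↓ ∈ s)` (`mem_doublyOccupied`). The generic lemma carries the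
`LinearOrder.toDecidableEq`-derived decidability instance on `Finset (Orb Λ)` inside `Matrix.diagonal`,
while the torus statement elaborates the default one; `Matrix.diagonal` does not depend on that
instance (`Subsingleton (DecidableEq _)`), which is the private helper below (re-proved from
`Theorems/WeakCouplingBCSWcbcsBcsConstructionLroSeedOfOrderFloor.lean`). Tasaki (2020) §9.3; Ueltschi,
J. Stat. Phys. 95 (1999) 693, §3 (classical on-site energy of the Hubbard model).
-/

set_option linter.dupNamespace false

namespace Summit.HubbardSuperconductivity.HubbardSuperconductivity.Theorems.TwSeededEnsembleEquivalence.ExposedDensity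

open Matrix Finset Literature.MathematicalPhysics.QuantumLattice Literature.Probability.LatticeModels
open scoped ComplexOrder Matrix.Norms.L2Operator

noncomputable section

-- adapted from `diagonal_eq_of_decEq` (Theorems/WeakCouplingBCSWcbcsBcsConstructionLroSeedOfOrderFloor.lean)
/-- `Matrix.diagonal` does not depend on the decidability instance. [folklore] -/
private theorem atomicDiag_diagonal_eq_of_decEq {n α : Type*} [Zero α] (i₁ i₂ : DecidableEq n)
    (d : n → α) : @diagonal n α i₁ _ d = @diagonal n α i₂ _ d := by
  have h : i₁ = i₂ := Subsingleton.elim _ _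
  subst h
  rfl

/-- The atomic-limit on-site energy at `μ = 0` on the torus is `U · D(s)`, with `D(s)` the literal
nested-filter doublon count of the skeleton (`doublyOccupied s = {x | x↑ ∈ s}.filter (x↓ ∈ s)` by
`mem_doublyOccupied`; stated at the torus so that the filters carry the statement's decidability
instances). [folklore] -/
private theorem atomicDiag_onSiteEnergy_zero (L : ℕ) (U : ℝ) :
    (onSiteEnergy (U : ℂ) ((0 : ℝ) : ℂ) : Finset (Orb (FermionTorus 2 L)) → ℂ) =
      fun s : Finset (Orb (FermionTorus 2 L)) =>
        (((U * (((Finset.univ.filter fun x : FermionTorus 2 L => orb x 0 ∈ s).filter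
          fun x => orb x 1 ∈ s).card : ℕ)) : ℝ) : ℂ) := by
  funext s
  have hc : doublyOccupied s =
      ((Finset.univ.filter fun x : FermionTorus 2 L => orb x 0 ∈ s).filter fun x => orb x 1 ∈ s) := by
    ext x
    simp only [mem_doublyOccupied, Finset.mem_filter, Finset.mem_univ, true_and]
  rw [onSiteEnergy, hc]
  push_cast
  ring

/-- **Barrier stub B1b — the atomic-limit Hubbard Hamiltonian is diagonal.** With hopping `t = 0`,
`hubbardTorus 2 L 0 U = diag(s ↦ U · D(s))`, where `D(s)` is the number of doubly occupied sites of the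
configuration `s` (the interaction `U Σ_x n_{x↑} n_{x↓}` is diagonal in the occupation basis,
`numberAt_eq_diagonal`; the hopping term vanishes). Tasaki (2020) §9.3. [folklore] -/
theorem stub_atomicHubbard_eq_diagonal :
    ∀ (L : ℕ) [NeZero L] (U : ℝ), hubbardTorus 2 L 0 U =
      Matrix.diagonal (fun s : Finset (Orb (FermionTorus 2 L)) =>
        (((U * (((Finset.univ.filter fun x : FermionTorus 2 L => orb x 0 ∈ s).filter fun x => orb x 1 ∈ s).card : ℕ)) : ℝ) : ℂ)) := by
  intro L _ U
  rw [← hubbardTorusWith_zero, hubbardTorusWith, hamiltonianWith_zero_hopping,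
    atomicDiag_onSiteEnergy_zero]
  exact atomicDiag_diagonal_eq_of_decEq _ _ _

end

end Summit.HubbardSuperconductivity.HubbardSuperconductivity.Theorems.TwSeededEnsembleEquivalence.ExposedDensity
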